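import Literature.Computability.Complexity.UniformDerandomizationTransducers
import Literature.Computability.Complexity.HashBricks
import Literature.Computability.Complexity.FoldBricks
import HarnessLib

/-!
# Wrapping a non-adaptive strong construction: run it at accuracy `2a` on a prefix of the coins and
# hand on the remaining coins (bricks for IW98 Def. 5, `C^{f,1−ρ} → C^f`, in transducer form)

Literature / complexity — derandomization under a uniform assumption (Case 2 of IW98). The strong
constructions of the uniform pipeline are truth-table transducers `ttFnAlgL Q q G`
(`UniformDerandomizationTransducers.lean`: `IWUniform.stronglyConstructibleUsing_of_ttFnL`; input
`strongInput n a r = ⟨1ⁿ, ⟨1ᵃ, r⟩⟩`, queries `Q ⟨x, 1ⁱ⟩` for `i < q(|x|)`, output `G ⟨x, code answers⟩`). A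
randomized post-processing of the output (here: the self-correction of `TVSelfCorrectCoins.lean`, which
needs fresh coins in the DESCRIPTION) is again such a transducer: on `x = ⟨1ⁿ, ⟨1ᵃ, r⟩⟩` run the given
one on `φ x = ⟨1ⁿ, ⟨1^{2a}, r ↾ m⟩⟩` (`m = p(n + 2a)` coins, accuracy `2a`) and output its output
together with `⟨1ᵃ, r⟩` minus the used prefix. This file builds the wrapper and proves its value for
EVERY oracle:

* `RSRWrap.phiF p` (`= strongInput n (2a) (r.take (p (n+2a)))`, `phiF_apply`), `RSRWrap.qryF Q q p`
  (query `i`: the given query `i` of `φ x` while `i < q(|φ x|)`, else the empty word; `qryF_apply`),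
  `RSRWrap.takeBodyF` (the nested-pair body of the first `k` items of a coded list, a counted fold from
  the back with additive growth; `takeBodyF_apply`), `RSRWrap.outF Q G q p` (`outF_apply`);
* **`RSRWrap.ttFnL_wrap`** — with `q' = q ∘ 2X`:
  `ttFnL (qryF Q q p) q' (outF Q G q p) O (strongInput n a r) = ⟨ttFnL Q q G O (φ x), ⟨1ᵃ, r.drop m⟩⟩`;
* `RSRWrap.qryF_mem_FP`, `RSRWrap.outF_mem_FP`.

Everything is proved; definitions are `FP` string functions (no named facts).

## References

* [ImpagliazzoWigderson2001] R. Impagliazzo, A. Wigderson, JCSS 63 (2001), §2.2 Defs. 4–5.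
* [LadnerLynchSelman1975] R. Ladner, N. Lynch, A. Selman, TCS 1 (1975), §3 (truth-table reductions).
* [AroraBarakCC2009] S. Arora, B. Barak, CUP 2009, §1.3, §7.4.1.
-/

noncomputable section

namespace Literature.Computability.Complexity

namespace IWUniform

namespace RSRWrap

open _root_.Computability Polynomial Brick Plumb HashBricks OracleCompose

variable (Q G : List Bool → List Bool) (q p : Polynomial ℕ)

/-! ### Reading `x = ⟨1ⁿ, ⟨1ᵃ, r⟩⟩` -/

/-- `1ⁿ` of `x`. [folklore] -/
def unF : List Bool → List Bool := fstF
/-- `1ᵃ` of `x`. [folklore] -/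
def uaF : List Bool → List Bool := fstF ∘ sndF
/-- `r` of `x`. [folklore] -/
def rF : List Bool → List Bool := sndF ∘ sndF
/-- `1^{p(n+2a)}`: the number of coins handed to the given construction. [folklore] -/
def mF : List Bool → List Bool := polyFn p ∘ appF ∘ fanoutFn unF (appF ∘ fanoutFn uaF uaF)

/-- The readers are in `FP`. [folklore] -/
theorem readers_mem_FP : unF ∈ FP ∧ uaF ∈ FP ∧ rF ∈ FP ∧ mF p ∈ FP := by
  have ha : uaF ∈ FP := comp_mem_FP fstF_mem_FP sndF_mem_FP
  exact ⟨fstF_mem_FP, ha, comp_mem_FP sndF_mem_FP sndF_mem_FP,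
    comp_mem_FP (polyFn_mem_FP _) (comp_mem_FP appF_mem_FP (fanoutFn_mem_FP fstF_mem_FP (comp_mem_FP appF_mem_FP (fanoutFn_mem_FP ha ha))))⟩

/-- `strongInput` with `ones`. [folklore] -/
theorem strongInput_eq (n a : ℕ) (r : List Bool) : strongInput n a r = boolPair (ones n) (boolPair (ones a) r) := by
  simp [strongInput, ones, unaryEncodeNat_eq_replicate]

/-- Values of the readers. [folklore] -/
theorem readers_apply (n a : ℕ) (r : List Bool) :
    unF (strongInput n a r) = ones n ∧ uaF (strongInput n a r) = ones a ∧ rF (strongInput n a r) = r ∧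
      mF p (strongInput n a r) = ones (p.eval (n + 2 * a)) := by
  simp [unF, uaF, rF, mF, strongInput_eq, ones, two_mul]

/-! ### The input of the given construction -/

/-- **`φ x = ⟨1ⁿ, ⟨1^{2a}, r ↾ p(n+2a)⟩⟩`.** [cite: ImpagliazzoWigderson2001, Def. 4] -/
def phiF : List Bool → List Bool :=
  fanoutFn unF (fanoutFn (appF ∘ fanoutFn uaF uaF) (takeFn ∘ fanoutFn (mF p) rF))

/-- `phiF ∈ FP`. [folklore] -/
theorem phiF_mem_FP : phiF p ∈ FP := by
  obtain ⟨hn, ha, hr, hm⟩ := readers_mem_FP p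
  exact fanoutFn_mem_FP hn (fanoutFn_mem_FP (comp_mem_FP appF_mem_FP (fanoutFn_mem_FP ha ha))
    (comp_mem_FP takeFn_mem_FP (fanoutFn_mem_FP hm hr)))

/-- Value of `phiF`. [folklore] -/
theorem phiF_apply (n a : ℕ) (r : List Bool) :
    phiF p (strongInput n a r) = strongInput n (2 * a) (r.take (p.eval (n + 2 * a))) := by
  obtain ⟨hn, ha, hr, hm⟩ := readers_apply p n a r
  rw [phiF]
  simp only [fanoutFn_apply, Function.comp_apply]
  rw [hn, ha, hr, hm, appF_boolPair, takeFn_boolPair]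
  simp only [strongInput_eq, ones, two_mul, List.replicate_append_replicate, List.length_replicate]

/-! ### The queries -/

/-- `1^{q(|φ x|)}` read off `⟨x, ·⟩`: the number of queries of the given construction. [folklore] -/
def kF : List Bool → List Bool := polyFn q ∘ phiF p ∘ fstF

/-- `kF ∈ FP`. [folklore] -/
theorem kF_mem_FP : kF q p ∈ FP := comp_mem_FP (polyFn_mem_FP _) (comp_mem_FP (phiF_mem_FP p) fstF_mem_FP)

/-- Value of `kF`. [folklore] -/
theorem kF_apply (x z : List Bool) : kF q p (boolPair x z) = ones (q.eval (phiF p x).length) := by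
  simp [kF]

/-- **The query function of the wrapper**: query `i` of the given construction on `φ x` while
`i < q(|φ x|)`, the empty word afterwards. [cite: LadnerLynchSelman1975, §3] -/
def qryF : List Bool → List Bool :=
  iteFn (ltLenF ∘ fanoutFn sndF (kF q p)) (Q ∘ fanoutFn (phiF p ∘ fstF) sndF) (fun _ => [])

/-- `qryF ∈ FP` for `Q ∈ FP`. [folklore] -/
theorem qryF_mem_FP (hQ : Q ∈ FP) : qryF Q q p ∈ FP :=
  iteFn_mem_FP (comp_mem_FP ltLenF_mem_FP (fanoutFn_mem_FP sndF_mem_FP (kF_mem_FP q p)))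
    (comp_mem_FP hQ (fanoutFn_mem_FP (comp_mem_FP (phiF_mem_FP p) fstF_mem_FP) sndF_mem_FP)) (const_mem_FP _)

/-- Value of the query function. [folklore] -/
theorem qryF_apply (x : List Bool) (i : ℕ) :
    qryF Q q p (boolPair x (List.replicate i true)) =
      if i < q.eval (phiF p x).length then Q (boolPair (phiF p x) (List.replicate i true)) else [] := by
  have hc : (ltLenF ∘ fanoutFn sndF (kF q p)) (boolPair x (List.replicate i true)) = [decide (i < q.eval (phiF p x).length)] := by
    simp [kF_apply, ones]
  rw [qryF, iteFn_apply hc]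
  by_cases h : i < q.eval (phiF p x).length
  · rw [decide_eq_true h, if_pos rfl, if_pos h]; simp
  · rw [decide_eq_false h, if_neg h]; simp

/-! ### The first `k` items of a coded list, re-coded -/

/-- A listed item is no longer than the body it sits in. [folklore] -/
theorem length_getD_le_body (l : List (List Bool)) (t : ℕ) : (l.getD t []).length ≤ (body l).length := by
  induction l generalizing t with
  | nil => simp
  | cons a l ih =>
    cases t with
    | zero => simp [body_cons]; omega
    | succ t => simp only [List.getD_cons_succ, body_cons, length_boolPair]; exact (ih t).trans (by omega)

/-- The piece of the re-coding fold on `⟨⟨1ᵏ, body⟩, 1ʲ⟩`: `⟨item (k−1−j), ε⟩`. [folklore] -/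
def pieceTB : List Bool → List Bool :=
  fanoutFn (nthItemFn ∘ fanoutFn (dropFn ∘ fanoutFn (List.cons true ∘ sndF) (fstF ∘ fstF)) (sndF ∘ fstF)) (fun _ => [])

/-- `pieceTB ∈ FP`. [folklore] -/
theorem pieceTB_mem_FP : pieceTB ∈ FP :=
  fanoutFn_mem_FP (comp_mem_FP nthItemFn_mem_FP (fanoutFn_mem_FP
    (comp_mem_FP dropFn_mem_FP (fanoutFn_mem_FP (comp_mem_FP (cons_mem_FP true) sndF_mem_FP) (comp_mem_FP fstF_mem_FP fstF_mem_FP)))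
    (comp_mem_FP sndF_mem_FP fstF_mem_FP))) (const_mem_FP _)

/-- Value of the piece. [folklore] -/
theorem pieceTB_apply (k : ℕ) (as : List (List Bool)) (j : ℕ) :
    pieceTB (boolPair (boolPair (ones k) (body as)) (ones j)) = boolPair (as.getD (k - 1 - j) []) [] := by
  simp only [pieceTB, fanoutFn_apply, Function.comp_apply, sndF_boolPair, fstF_boolPair, dropFn_boolPair]
  rw [show (true :: ones j).length = j + 1 by simp [ones], show (ones k).drop (j + 1) = ones (k - 1 - j) by
    rw [ones, ones, List.drop_replicate]; congr 1; omega, nthItemFn_body]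

/-- The operation of the re-coding fold: `⟨acc, ⟨item, ε⟩⟩ ↦ ⟨item, acc⟩`. [folklore] -/
def opTB : List Bool → List Bool := fanoutFn (fstF ∘ sndF) fstF

/-- `opTB ∈ FP`. [folklore] -/
theorem opTB_mem_FP : opTB ∈ FP := fanoutFn_mem_FP (comp_mem_FP fstF_mem_FP sndF_mem_FP) fstF_mem_FP

/-- Value of the operation. [folklore] -/
@[simp] theorem opTB_apply (acc item pad : List Bool) : opTB (boolPair acc (boolPair item pad)) = boolPair item acc := by
  simp [opTB]

/-- **Additive growth of the operation** (the piece carries the factor `2` of `boolPair`). [folklore] -/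
theorem length_opTB_le (w : List Bool) : (opTB w).length ≤ (fstF w).length + (sndF w).length + 2 := by
  have h := length_boolUnpair_parts_le (sndF w)
  rw [opTB, fanoutFn_apply, length_boolPair]
  change 2 * (fstF (sndF w)).length + 2 + (fstF w).length ≤ _
  change 2 * (fstF (sndF w)).length + (sndF (sndF w)).length ≤ (sndF w).length at h
  omega

/-- Initialisation of the re-coding fold on `Z = ⟨1ᵏ, body⟩`: counter `encodeNat k`, accumulator `ε`. [folklore] -/
def initTB : List Bool → List Bool := fanoutFn (fun Z => Z) (fanoutFn (lenBinF ∘ fstF) (fun _ => boolPair [] []))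

/-- `initTB ∈ FP`. [folklore] -/
theorem initTB_mem_FP : initTB ∈ FP :=
  fanoutFn_mem_FP (PolyTimeComputable.id _) (fanoutFn_mem_FP (comp_mem_FP lenBinF_mem_FP fstF_mem_FP) (const_mem_FP _))

/-- **The re-coded body of the first `k` items**: `takeBodyF ⟨1ᵏ, body as⟩ = body (as.take k)` (`k ≤ |as|`).
[folklore] -/
def takeBodyF : List Bool → List Bool := sndPow 2 ∘ foldLoop opTB (clipF 2 pieceTB) X ∘ initTB

/-- `takeBodyF ∈ FP`. [folklore] -/
theorem takeBodyF_mem_FP : takeBodyF ∈ FP :=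
  comp_mem_FP (sndPow_mem_FP 2) (comp_mem_FP (foldLoop_clipF_mem_FP 2 opTB_mem_FP length_opTB_le pieceTB_mem_FP _) initTB_mem_FP)

/-- The model of the fold: after `j` rounds the accumulator is the body of the last `j` of the first `k`
items. [folklore] -/
theorem foldAcc_opTB (k : ℕ) (as : List (List Bool)) (hk : k ≤ as.length) :
    ∀ j, j ≤ k → foldAcc opTB pieceTB (boolPair (ones k) (body as)) 0 j [] = body ((as.take k).drop (k - j))
  | 0, _ => by simp
  | j + 1, hj => by
    rw [foldAcc_succ', foldAcc_opTB k as hk j (by omega), Nat.zero_add, pieceTB_apply, opTB_apply]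
    have hlen : (as.take k).length = k := List.length_take_of_le hk
    have hlt : k - 1 - j < (as.take k).length := by rw [hlen]; omega
    rw [show k - (j + 1) = k - 1 - j by omega, List.drop_eq_getElem_cons hlt, body_cons, show k - 1 - j + 1 = k - j by omega]
    congr 1
    rw [List.getD_eq_getElem _ _ (by omega), List.getElem_take]

/-- **Value of the re-coding.** [folklore] -/
theorem takeBodyF_apply (k : ℕ) (as : List (List Bool)) (hk : k ≤ as.length) :
    takeBodyF (boolPair (ones k) (body as)) = body (as.take k) := by
  have hinit : initTB (boolPair (ones k) (body as)) =
      boolPair (boolPair (ones k) (body as)) (boolPair (encodeNat k) (boolPair (ones 0) [])) := by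
    simp [initTB, ones]
  have hrounds : k ≤ (X : Polynomial ℕ).eval (boolPair (ones k) (body as)).length := by
    simp [ones]; omega
  rw [takeBodyF, Function.comp_apply, Function.comp_apply, hinit, foldLoop_apply opTB (clipF 2 pieceTB) hrounds 0 [],
    sndPow_succ_boolPair, sndPow_succ_boolPair, sndPow_zero_boolPair, foldAcc_clipF (fun j _ hj => ?_),
    foldAcc_opTB k as hk k le_rfl, Nat.sub_self, List.drop_zero]
  rw [pieceTB_apply, length_boolPair, length_boolPair, List.length_nil]
  have := length_getD_le_body as (k - 1 - j)
  omega


/-! ### The output -/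

/-- The `listBool` code of a list of strings is `⟨1^{|as|}, body as⟩`. [folklore] -/
theorem listBool_encode_body (as : List (List Bool)) :
    (encodingList Bool).listBool.encode as = boolPair (unaryEncodeNat as.length) (body as) := by
  change boolPair (unaryEncodeNat as.length) (as.foldr (fun a acc => boolPair ((encodingList Bool).encode a) acc) []) = _
  rfl

/-- **The output function of the wrapper** on `⟨x, code as⟩`: the given output on `⟨φ x, code (as ↾ k)⟩`,
`k = q(|φ x|)`, paired with `⟨1ᵃ, r⟩` minus the used coins. [cite: ImpagliazzoWigderson2001, Defs. 4–5] -/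
def outF : List Bool → List Bool :=
  fanoutFn (G ∘ fanoutFn (phiF p ∘ fstF) (fanoutFn (kF q p) (takeBodyF ∘ fanoutFn (kF q p) (sndF ∘ sndF))))
    (fanoutFn (uaF ∘ fstF) (dropFn ∘ fanoutFn (mF p ∘ fstF) (rF ∘ fstF)))

/-- `outF ∈ FP` for `G ∈ FP`. [folklore] -/
theorem outF_mem_FP (hG : G ∈ FP) : outF G q p ∈ FP := by
  obtain ⟨-, ha, hr, hm⟩ := readers_mem_FP p
  have hk := kF_mem_FP q p
  exact fanoutFn_mem_FP (comp_mem_FP hG (fanoutFn_mem_FP (comp_mem_FP (phiF_mem_FP p) fstF_mem_FP)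
      (fanoutFn_mem_FP hk (comp_mem_FP takeBodyF_mem_FP (fanoutFn_mem_FP hk (comp_mem_FP sndF_mem_FP sndF_mem_FP))))))
    (fanoutFn_mem_FP (comp_mem_FP ha fstF_mem_FP) (comp_mem_FP dropFn_mem_FP
      (fanoutFn_mem_FP (comp_mem_FP hm fstF_mem_FP) (comp_mem_FP hr fstF_mem_FP))))

/-- **Value of the output function.** [folklore] -/
theorem outF_apply (n a : ℕ) (r : List Bool) (as : List (List Bool))
    (hk : q.eval (phiF p (strongInput n a r)).length ≤ as.length) :
    outF G q p (boolPair (strongInput n a r) ((encodingList Bool).listBool.encode as)) =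
      boolPair (G (boolPair (phiF p (strongInput n a r))
          ((encodingList Bool).listBool.encode (as.take (q.eval (phiF p (strongInput n a r)).length)))))
        (boolPair (ones a) (r.drop (p.eval (n + 2 * a)))) := by
  obtain ⟨-, ha, hr, hm⟩ := readers_apply p n a r
  rw [listBool_encode_body, listBool_encode_body, List.length_take_of_le hk]
  simp only [outF, fanoutFn_apply, Function.comp_apply, fstF_boolPair, sndF_boolPair, kF_apply, ha, hr, hm, dropFn_boolPair,
    takeBodyF_apply _ as hk, ones, List.length_replicate, unaryEncodeNat_eq_replicate]

/-! ### The value of the wrapped transducer -/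

/-- Monotonicity of polynomial evaluation over `ℕ`. [folklore] -/
theorem eval_mono_nat (f : Polynomial ℕ) {u v : ℕ} (h : u ≤ v) : f.eval u ≤ f.eval v := by
  rw [Polynomial.eval_eq_sum_range, Polynomial.eval_eq_sum_range]
  exact Finset.sum_le_sum fun i _ => Nat.mul_le_mul_left _ (Nat.pow_le_pow_left h i)

/-- `|φ x| ≤ 2 |x|`. [folklore] -/
theorem length_phiF_le (n a : ℕ) (r : List Bool) : (phiF p (strongInput n a r)).length ≤ 2 * (strongInput n a r).length := by
  have h1 : (phiF p (strongInput n a r)).length = 2 * n + 2 + (2 * (2 * a) + 2 + (r.take (p.eval (n + 2 * a))).length) := by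
    rw [phiF_apply, strongInput_eq, length_boolPair, length_boolPair]; simp only [ones, List.length_replicate]
  have h2 : (strongInput n a r).length = 2 * n + 2 + (2 * a + 2 + r.length) := by
    rw [strongInput_eq, length_boolPair, length_boolPair]; simp only [ones, List.length_replicate]
  have h3 : (r.take (p.eval (n + 2 * a))).length ≤ r.length := List.length_take_le' _ _
  omega

/-- **The wrapped transducer computes the given one on `φ x` and hands on the unused coins**, for every
oracle. [cite: ImpagliazzoWigderson2001, Defs. 4–5] [cite: LadnerLynchSelman1975, §3] -/
theorem ttFnL_wrap (O : Oracle) (n a : ℕ) (r : List Bool) :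
    ttFnL (qryF Q q p) (q.comp (2 * X)) (outF G q p) O (strongInput n a r) =
      boolPair (ttFnL Q q G O (phiF p (strongInput n a r))) (boolPair (ones a) (r.drop (p.eval (n + 2 * a)))) := by
  have hK : q.eval (phiF p (strongInput n a r)).length ≤ (q.comp (2 * X)).eval (strongInput n a r).length := by
    rw [eval_comp, eval_mul, eval_ofNat, eval_X]
    exact eval_mono_nat q (length_phiF_le p n a r)
  rw [ttFnL_apply]
  set as := (ttQueries (qryF Q q p) (strongInput n a r) ((q.comp (2 * X)).eval (strongInput n a r).length)).map O with has
  have hlen : q.eval (phiF p (strongInput n a r)).length ≤ as.length := by rwa [has, List.length_map, length_ttQueries]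
  rw [outF_apply G q p n a r as hlen, ttFnL_apply]
  congr 3
  -- the first `k` answers are the answers to the given construction's queries on `φ x`
  rw [has, ← List.map_take, ttQueries, ← List.map_take, List.take_range, Nat.min_eq_left hK, ttQueries, List.map_map,
    List.map_map]
  refine congrArg _ (List.map_congr_left fun i hi => ?_)
  simp only [Function.comp_apply]
  rw [qryF_apply, if_pos (List.mem_range.1 hi)]

end RSRWrap

end IWUniform

end Literature.Computability.Complexity

end
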